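import Mathlib.Data.ZMod.Basic
import Literature.Probability.LatticeModels.LatticeGraph
import Literature.Probability.LatticeModels.Correlations
import Literature.Probability.LatticeModels.IsingModel
import Literature.Probability.LatticeModels.TorusFourier
import Literature.Probability.LatticeModels.ReflectionPositivity
import HarnessLib

-- provenance: harness21/H21/H21/Statements/CritIsing/InfraredBound.lean @ a991ad1 (interim HEAD d8f2665); M5 mechanical rewrite
/-!
# Critical Ising family: reflection positivity and the infrared bound on the torus

Trunk G02 (T-STATMECH), statement file `Statements/CritIsing/InfraredBound.lean`
(family `crit-ising`).

## Covered statement ids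

* **crit-ising.S12** — reflection positivity of the nearest-neighbour Ising Gibbs measure on the
  discrete torus `(ℤ/Lℤ)^d` (`L` even) with respect to reflections through sites and through the
  hyperplanes bisecting bonds (Fröhlich–Israel–Lieb–Simon, *Phase transitions and reflection
  positivity I*, Comm. Math. Phys. **62** (1978), §2, Thm. 2.1 and the discussion of n.n.
  interactions; Biskup, *Reflection positivity and phase transitions in lattice spin models*,
  LNM 1970 (2009), Lemma 5.3 / Thm. 5.4), together with reflection invariance.
  The "chessboard estimates" half of the inventory text is **not** formalised in v0
  (outline R5); the id is attached to the RP statements only and the docstrings say so.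
* **crit-ising.S11** — the infrared bound of Fröhlich–Simon–Spencer (Comm. Math. Phys. **50**
  (1976), Thm. 3.1; Fröhlich–Israel–Lieb–Simon 1978, Cor. 2.4; Friedli–Velenik, *Statistical
  Mechanics of Lattice Systems* (2017), Thm. 10.24 specialised to `N = 1`):
  `Ĝ_L(p) ≤ 1 / (2β ∑ᵢ (1 - cos pᵢ))` for `p ≠ 0`.

## Conventions and design choices

* All objects come from the StatMech prelude: `isingTorusMeasure d L β h` (P5; Hamiltonian
  `-∑_{edges} σ_x σ_y - h ∑ σ_x`, each nearest-neighbour edge of `torusGraph d L` counted once,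
  weight `e^{-βH}`), `IsReflectionPositive`, `IsReflectionInvariant`,
  `Torus.reflectThroughSites/BetweenSites`, `Torus.halfThroughSites/BetweenSites` (P19),
  `twoPointFourierTorus`, `latticeMomentum`, `dispersion` (P10). Nothing new is defined here;
  Mathlib has no reflection positivity or infrared bound (searched `ReflectionPositiv`,
  `infrared`, `GaussianDomination`).
* Normalisation of S11. `twoPointFourierTorus μ k = ∑_x G_L(x) e^{-i p·x}` is the *unnormalised*
  sum, `p = latticeMomentum L k = 2πk/L`, and `G_L(x) = ⟨σ_0 σ_x⟩` is the expectation of the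
  product (`G_L(0) = 1`). This is exactly `Ĝ_L(p)` of Friedli–Velenik (10.36) and of
  Fernández–Fröhlich–Sokal (1992) §1.2, for which the FSS bound reads
  `Ĝ_L(p) ≤ [2 β ∑ᵢ (1 - cos pᵢ)]⁻¹`; no `|Λ|`-normalisation adjustment is needed. (Derivation of
  the constant: `-σ_xσ_y = ½(σ_x-σ_y)² - 1`, so `e^{-βH}` is `e^{-(β/2)(σ,-Δσ)}` times a constant;
  Gaussian domination gives `⟨|σ̂(p)|²⟩ ≤ |Λ| / (β · 2∑ᵢ(1 - cos pᵢ))` and `⟨|σ̂(p)|²⟩ = |Λ| Ĝ_L(p)`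
  by translation invariance.) The bound was checked numerically on small tori.
* Torus size. RP through bonds and the FSS argument need `L` even (outline R9: explicit `Even L`
  hypotheses). For `L = 2` the prelude's `torusGraph d 2` is a *simple* graph (the two bonds
  `x ∼ x ± eᵢ` of the periodic torus coincide and are counted once), so the coupling is half the
  periodic one and the bound with constant `2β` genuinely fails (e.g. `d = 1`, `L = 2`,
  `β = 1/2`: `Ĝ(π) = 1 - tanh β ≈ 0.538 > 1/(4β) = 0.5`). Hence S11 carries the extra hypothesis
  `L ≠ 2` (with `Even L` and `L ≠ 0` this is `4 ≤ L`). The RP statements S12 hold for every even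
  `L` (for `L = 2` the site reflection is the identity and the bond transfer matrix `e^{βσσ'}` is
  positive definite), so they keep the outline's shape.
* Proofs are `sorry` with citations (known theorems in print).
-/

noncomputable section

open MeasureTheory Literature.Probability.LatticeModels

namespace Literature.Probability.LatticeModels

variable {d L : ℕ} [NeZero L]

/-! ### crit-ising.S12: reflection positivity of the torus Ising measure -/

/-- **crit-ising.S12** (reflection invariance part; Fröhlich–Israel–Lieb–Simon 1978 §2;
Biskup 2009 §5.1). The nearest-neighbour Ising Gibbs measure on the torus `(ℤ/Lℤ)^d` is
invariant under the reflections through sites `x_i ↦ 2k - x_i` and between sites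
`x_i ↦ 2k + 1 - x_i`: both are graph automorphisms of `torusGraph d L`, hence preserve the
Hamiltonian and the uniform reference measure. (No parity or sign hypothesis is needed for
invariance.) Chessboard estimates, mentioned in the inventory text of S12, are **not** formalised
in v0 (outline R5). [cite: FrohlichIsraelLiebSimon1978, §2] -/
def isingTorus_reflectionInvariant : Prop :=
  ∀ (β h : ℝ) (i : Fin d) (k : ZMod L),
    IsReflectionInvariant (isingTorusMeasure d L β h) (Torus.reflectThroughSites i k) ∧
      IsReflectionInvariant (isingTorusMeasure d L β h) (Torus.reflectBetweenSites i k)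

/-- **crit-ising.S12** (reflections through sites; Fröhlich–Israel–Lieb–Simon, CMP 62 (1978), §2,
Thm. 2.1 with the n.n. example; Biskup, LNM 1970 (2009), Lemma 5.3). For even `L` and `β ≥ 0`
the nearest-neighbour Ising Gibbs measure on the torus `(ℤ/Lℤ)^d` (any external field `h`) is
reflection positive with respect to the reflection through the sites `x_i = k`, `x_i = k + L/2`
and the half-torus `Torus.halfThroughSites i k` between them: for every bounded observable `F`
depending only on spins in the half-torus, `0 ≤ Re ⟨conj (F ∘ θ) · F⟩`. (For site reflections
the sign of `β` is in fact immaterial; the hypothesis follows the outline.)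
The "chessboard estimates" of the inventory text are **not** formalised in v0 (outline R5):
this id covers reflection positivity only. [cite: LNM1970, (2009] -/
def isingTorus_reflectionPositive_sites : Prop :=
  ∀ (hL : Even L) (i : Fin d) (k : ZMod L) {β : ℝ} (hβ : 0 ≤ β) (h : ℝ),
    IsReflectionPositive (isingTorusMeasure d L β h) (Torus.reflectThroughSites i k)
      (Torus.halfThroughSites i k)

/-- **crit-ising.S12** (reflections through planes bisecting bonds; Fröhlich–Israel–Lieb–Simon,
CMP 62 (1978), §2, Thm. 2.1 with the n.n. ferromagnetic example; Biskup, LNM 1970 (2009),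
Lemma 5.3 / Thm. 5.4). For even `L` and ferromagnetic coupling `β ≥ 0` the nearest-neighbour
Ising Gibbs measure on the torus `(ℤ/Lℤ)^d` (any external field `h`) is reflection positive with
respect to the reflection `x_i ↦ 2k + 1 - x_i` through the hyperplanes bisecting the bonds
`{k, k+1}`, `{k + L/2, k + L/2 + 1}` in direction `i`, with positive half-torus
`Torus.halfBetweenSites i k`.
The "chessboard estimates" of the inventory text are **not** formalised in v0 (outline R5):
this id covers reflection positivity only. [cite: LNM1970, (2009] -/
def isingTorus_reflectionPositive_bonds : Prop :=
  ∀ (hL : Even L) (i : Fin d) (k : ZMod L) {β : ℝ} (hβ : 0 ≤ β) (h : ℝ),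
    IsReflectionPositive (isingTorusMeasure d L β h) (Torus.reflectBetweenSites i k)
      (Torus.halfBetweenSites i k)

/-! ### crit-ising.S11: the infrared bound -/

/-- **crit-ising.S11** (infrared bound; Fröhlich–Simon–Spencer, CMP 50 (1976), Thm. 3.1;
Fröhlich–Israel–Lieb–Simon, CMP 62 (1978), Cor. 2.4; Friedli–Velenik 2017, Thm. 10.24 with
`N = 1`). For the nearest-neighbour Ising model at inverse temperature `β > 0` and zero field on
the torus `(ℤ/Lℤ)^d`, `L` even, `L ≠ 2`, the Fourier transform
`Ĝ_L(p) = ∑_x ⟨σ_0 σ_x⟩ e^{-i p·x}` (unnormalised sum, Friedli–Velenik (10.36); here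
`twoPointFourierTorus`, with `G_L(0) = 1`) of the two-point function satisfies, for every
non-zero `k ∈ (ℤ/Lℤ)^d` with lattice momentum `p = 2πk/L`,
`Ĝ_L(p) ≤ 1 / (2 β ∑ᵢ (1 - cos pᵢ))` (Gaussian domination from reflection positivity through
bonds). `Ĝ_L(p)` is real (`infraredBound_im`), so the bound is stated on the real part; the
denominator is positive for `k ≠ 0` (`dispersion_latticeMomentum_eq_zero_iff`). The hypothesis
`L ≠ 2` excludes the degenerate simple-graph torus of side `2`, where each periodic double bond
is counted once and the constant `2β` fails (module docstring). [cite: FriedliVelenik2017, Thm. 10.24 with  N = 1] -/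
def infraredBound : Prop :=
  ∀ (hL : Even L) (hL2 : L ≠ 2) {β : ℝ} (hβ : 0 < β) (k : TorusSite d L) (hk : k ≠ 0),
    (twoPointFourierTorus (isingTorusMeasure d L β 0) k).re ≤
      1 / (2 * β * dispersion (latticeMomentum L k))

/-- **crit-ising.S11** (reality of `Ĝ_L`; Fröhlich–Simon–Spencer 1976, §3; Friedli–Velenik 2017,
discussion after (10.36)). The torus Ising measure is invariant under `x ↦ -x` (a composition of
site reflections, `isingTorus_reflectionInvariant`), so its two-point function is even and the
Fourier transform `Ĝ_L(p)` is real: the imaginary part of `twoPointFourierTorus` vanishes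
(cf. `twoPointFourierTorus_im_eq_zero`). No parity, sign or `k ≠ 0` hypothesis is needed. [cite: FrohlichSimonSpencer1976, §3] -/
def infraredBound_im : Prop :=
  ∀ (β h : ℝ) (k : TorusSite d L),
    (twoPointFourierTorus (isingTorusMeasure d L β h) k).im = 0

end Literature.Probability.LatticeModels
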